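import Literature.NumberTheory.GaloisRepresentations.LocalCorInjective
import Literature.NumberTheory.GaloisRepresentations.RelativeCorestrictionConj
import Literature.NumberTheory.GaloisRepresentations.ConjugationDescent
import HarnessLib

/-!
# `Γ_F` acts trivially on `H²(S, μ_{p^k})` for open `S ⊴ Γ_F` with `Γ_F/S` abelian (`F` local, `k ≥ 2`)

For a non-archimedean local field `F` of characteristic `0`, an open normal subgroup `S ⊴ Γ_F` with
ABELIAN quotient `Γ_F/S` (e.g. `S = Gal(F̄/E)` for a finite abelian extension `E/F`), `p` prime,
`k ≥ 2` and every `g ∈ Γ_F`, the conjugation action `g · : H²(S, μ_{p^k}) → H²(S, μ_{p^k})` of the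
tree (`conjMap`, `ContinuousCorestriction.lean`) is the IDENTITY (`conjMap_two_mu_eq_self_of_comm_mem`).
Classically this is the Galois-equivariance of the local invariant map `inv_E : H²(E, μ_n) ⥲ ℤ/n`
(`inv_{gE} ∘ g_* = inv_E`, Serre *Corps locaux* XI §2 Prop. 1 (ii) / XIII §3 Prop. 7), i.e. the
INJECTIVITY of `inv_F ∘ cor_{E/F} = inv_E` — for `p ∣ [E:F]` NOT covered by the tree's
`eq_zero_of_cor_two_mu_eq_zero` (`LocalCorInjective.lean`, `p ∤ (Γ_F : S)` only).

THE PROOF HERE IS ELEMENTARY given what the tree already holds — `|H²(S, μ_n)| = n`, cyclic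
(`natCard_two_mu_eq`, `isAddCyclic_two_mu`, from local class field theory), `cor ∘ res = (V : V')`
(`cor_resH`), `cor ∘ (g ·) = (g ·) ∘ cor` (`relCor_conjMap`), `res ∘ (g ·) = (g ·) ∘ res`
(`resLe_conjMap`, here), and `g ∈ V` acts trivially on `H²(V, ·)` (`conjMap_eq_self_of_mem_two`):

* §1 (finite cyclic groups) `surjective_or_injective_of_comp_eq_prime_nsmul`: if `A`, `B` are
  cyclic of order `p^k`, `k ≥ 2`, `res : A → B`, `cor : B → A`, `cor ∘ res = ℓ` with `ℓ` prime, then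
  `res` is surjective or `cor` is injective (writing `res a₀ = r b₀`, `cor b₀ = c a₀` on generators,
  `rc ≡ ℓ (mod p^k)` with `k ≥ 2` forbids `p ∣ r` and `p ∣ c` simultaneously); hence an endomorphism
  `φ` of `B` with `cor ∘ φ = cor` and `φ ∘ res = res` is the identity
  (`eq_self_of_comp_eq_of_comp_eq`);
* §2 (profinite groups) `resLe_conjMap`, `toSubgroupOf_resLe`, `relCor_resLe`
  (`cor_{V/V'} ∘ res_{V'/V} = (V : V')` in the relative dialect of `RelativeCorestrictionConj.lean`);
* §3 (local fields) the one-step descent `conjMap_two_mu_eq_self_of_step` along `V' ≤ V` of prime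
  index, and the induction on `(Γ_F : S)` along a chain `S = V_m ≤ … ≤ V_0 = Γ_F` of normal subgroups
  with prime steps, which exists because `Γ_F/S` is abelian (Cauchy) — `conjMap_two_mu_eq_self_of_comm_mem`.

The restriction `k ≥ 2` is where the counting argument needs `p² ∣ p^k`; consumers with `p^e`-fudge
(`e ≥ 1`) lose nothing since `H²(S, μ_p)` is `p`-torsion. Generic in the local field `F`; THEOREMS ONLY
(no definition, no named fact, no instance, no `sorry`). Consumer: the class-group row of the two-variable
main conjecture at `p = 2` (`JohnsonLeungKings2011.ClassGroupRow.conjMap_two_eq_zsmul_of_untwisted_trivial`,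
hypothesis `hLI`), via `muLocalIso` (`LocalGlobalCohomologyTateProofs.lean`).

## References
* J.-P. Serre, *Local Fields* (1979), XI §2 Prop. 1 (ii), XIII §3 Prop. 7, Cor. 3. [SerreLocalFields1979]
* J.-P. Serre, *Galois Cohomology* (1997), I §2.4 Prop. 9, I §2.5, II §5.2. [SerreGaloisCohomology1997]
* J. Neukirch, A. Schmidt, K. Wingberg, *Cohomology of Number Fields* (2008), I §5 Prop. 1.5.4,
  II §7 Cor. 7.1.4 (`cor` on `H²(·, μ_n)` of local fields is the identity on invariants). [NeukirchSchmidtWingberg2008]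
-/

noncomputable section

open CategoryTheory Function Field

universe u

namespace Literature.NumberTheory.GaloisRepresentations

open _root_.TopRep _root_.ContRepresentation _root_.ContinuousCohomology DiscreteGaloisModule
open Literature.NumberTheory.EllipticCurves (subgroupConj subgroupConj_apply_coe subgroupInclusion)

/-! ### §1 Finite cyclic groups: `cor ∘ res = ℓ` with `|A| = |B| = p^k`, `k ≥ 2` -/

section Algebra

variable {A B : Type*} [AddCommGroup A] [AddCommGroup B] [Finite B]

/-- `p² ∤ ℓ` for primes `p`, `ℓ`. [folklore] -/
private theorem not_sq_dvd_prime {p ℓ : ℕ} (hp : p.Prime) (hℓ : ℓ.Prime) : ¬p ^ 2 ∣ ℓ := by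
  intro h
  rcases (Nat.dvd_prime hℓ).mp h with h1 | h1
  · exact (Nat.one_lt_pow two_ne_zero hp.one_lt).ne' h1
  · have hpd : p ∣ ℓ := h1 ▸ dvd_pow_self p two_ne_zero
    rcases (Nat.dvd_prime hℓ).mp hpd with h2 | h2
    · exact hp.one_lt.ne' h2
    · rw [h2, sq] at h1
      exact hℓ.one_lt.ne' (Nat.eq_of_mul_eq_mul_left hℓ.pos (h1.trans (mul_one ℓ).symm))

/-- **`cor ∘ res = ℓ` between cyclic groups of the same order `p^k`, `k ≥ 2`, `ℓ` prime ⇒ `res` is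
surjective or `cor` is injective.** On generators `res a₀ = r·b₀`, `cor b₀ = c·a₀`, so
`rc ≡ ℓ (mod p^k)`; as `p² ∣ p^k` and `p² ∤ ℓ`, not both `p ∣ r` and `p ∣ c`; a unit `r` makes `res`
surjective, a unit `c` makes `cor` surjective, hence injective (equal finite cardinalities).
[cite: SerreGaloisCohomology1997, I §2.4 Prop. 9 (the use of `cor ∘ res = (G:H)`)] -/
theorem surjective_or_injective_of_comp_eq_prime_nsmul (hA : IsAddCyclic A) (hB : IsAddCyclic B)
    {p k ℓ : ℕ} (hp : p.Prime) (hk : 2 ≤ k) (hℓ : ℓ.Prime) (hcA : Nat.card A = p ^ k)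
    (hcB : Nat.card B = p ^ k) (res : A →+ B) (cor : B →+ A) (hcr : ∀ a, cor (res a) = ℓ • a) :
    Surjective res ∨ Injective cor := by
  have hP : Prime (p : ℤ) := Nat.prime_iff_prime_int.mp hp
  obtain ⟨a₀, ha₀⟩ := @IsAddCyclic.exists_generator A _ hA
  obtain ⟨b₀, hb₀⟩ := @IsAddCyclic.exists_generator B _ hB
  have hoa : addOrderOf a₀ = p ^ k := (addOrderOf_eq_card_of_forall_mem_zmultiples ha₀).trans hcA
  have hob : addOrderOf b₀ = p ^ k := (addOrderOf_eq_card_of_forall_mem_zmultiples hb₀).trans hcB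
  have hpka : ((p : ℤ) ^ k) • a₀ = 0 :=
    (addOrderOf_dvd_iff_zsmul_eq_zero (x := a₀)).mp (by rw [hoa, Nat.cast_pow])
  have hpkb : ((p : ℤ) ^ k) • b₀ = 0 :=
    (addOrderOf_dvd_iff_zsmul_eq_zero (x := b₀)).mp (by rw [hob, Nat.cast_pow])
  obtain ⟨r, hr⟩ := AddSubgroup.mem_zmultiples_iff.mp (hb₀ (res a₀))
  obtain ⟨c, hc⟩ := AddSubgroup.mem_zmultiples_iff.mp (ha₀ (cor b₀))
  have key : (p : ℤ) ^ k ∣ r * c - ℓ := by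
    have h0 : (r * c - (ℓ : ℤ)) • a₀ = 0 := by
      rw [sub_zsmul, mul_zsmul, hc, ← map_zsmul, hr, hcr, natCast_zsmul]
      simp
    have h1 := (addOrderOf_dvd_iff_zsmul_eq_zero (x := a₀)).mpr h0
    rwa [hoa, Nat.cast_pow] at h1
  have hp2 : (p : ℤ) ^ 2 ∣ r * c - ℓ := (pow_dvd_pow _ hk).trans key
  have not_both : ¬((p : ℤ) ∣ r ∧ (p : ℤ) ∣ c) := by
    rintro ⟨hr', hc'⟩
    have h1 : (p : ℤ) ^ 2 ∣ r * c := by rw [sq]; exact mul_dvd_mul hr' hc'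
    have h2 : (p : ℤ) ^ 2 ∣ (ℓ : ℤ) := by
      have h3 := dvd_sub h1 hp2
      rwa [sub_sub_cancel] at h3
    exact not_sq_dvd_prime hp hℓ (by exact_mod_cast h2)
  by_cases hpr : (p : ℤ) ∣ r
  · right
    have hpc : ¬(p : ℤ) ∣ c := fun h => not_both ⟨hpr, h⟩
    obtain ⟨u, w, huw⟩ := (((Prime.coprime_iff_not_dvd hP).mpr hpc).symm.pow_right :
      IsCoprime c ((p : ℤ) ^ k))
    have hsurj : Surjective cor := by
      intro a
      obtain ⟨m, hm⟩ := AddSubgroup.mem_zmultiples_iff.mp (ha₀ a)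
      refine ⟨(m * u) • b₀, ?_⟩
      calc cor ((m * u) • b₀) = (m * u) • cor b₀ := map_zsmul _ _ _
        _ = m • ((u * c) • a₀) := by rw [← hc, mul_zsmul, mul_zsmul]
        _ = m • ((u * c + w * (p : ℤ) ^ k) • a₀) := by
          rw [add_zsmul, mul_zsmul a₀ w, hpka, zsmul_zero, add_zero]
        _ = a := by rw [huw, one_zsmul, hm]
    exact ((Nat.bijective_iff_surjective_and_card cor).mpr ⟨hsurj, hcB.trans hcA.symm⟩).1
  · left
    obtain ⟨u, w, huw⟩ := (((Prime.coprime_iff_not_dvd hP).mpr hpr).symm.pow_right :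
      IsCoprime r ((p : ℤ) ^ k))
    intro b
    obtain ⟨m, hm⟩ := AddSubgroup.mem_zmultiples_iff.mp (hb₀ b)
    refine ⟨(m * u) • a₀, ?_⟩
    calc res ((m * u) • a₀) = (m * u) • res a₀ := map_zsmul _ _ _
      _ = m • ((u * r) • b₀) := by rw [← hr, mul_zsmul, mul_zsmul]
      _ = m • ((u * r + w * (p : ℤ) ^ k) • b₀) := by
        rw [add_zsmul, mul_zsmul b₀ w, hpkb, zsmul_zero, add_zero]
      _ = b := by rw [huw, one_zsmul, hm]

/-- **An endomorphism `φ` of `B` commuting with `res` and `cor` in the sense `cor ∘ φ = cor`,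
`φ ∘ res = res` is the identity** (same hypotheses: `res` surjective or `cor` injective).
[cite: SerreGaloisCohomology1997, I §2.4 Prop. 9] -/
theorem eq_self_of_comp_eq_of_comp_eq (hA : IsAddCyclic A) (hB : IsAddCyclic B)
    {p k ℓ : ℕ} (hp : p.Prime) (hk : 2 ≤ k) (hℓ : ℓ.Prime) (hcA : Nat.card A = p ^ k)
    (hcB : Nat.card B = p ^ k) (res : A →+ B) (cor : B →+ A) (hcr : ∀ a, cor (res a) = ℓ • a)
    (φ : B → B) (h1 : ∀ b, cor (φ b) = cor b) (h2 : ∀ a, φ (res a) = res a) (b : B) : φ b = b := by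
  rcases surjective_or_injective_of_comp_eq_prime_nsmul hA hB hp hk hℓ hcA hcB res cor hcr with
    hres | hcor
  · obtain ⟨a, rfl⟩ := hres b
    exact h2 a
  · exact hcor (h1 b)

end Algebra

/-! ### §2 Profinite groups: `res ∘ (g ·) = (g ·) ∘ res` and `cor_{V/V'} ∘ res = (V : V')` -/

section Profinite

variable {Γ : Type u} [Group Γ] [TopologicalSpace Γ] [IsTopologicalGroup Γ] [CompactSpace Γ]
  [T2Space Γ] [TotallyDisconnectedSpace Γ]
variable (V V' : Subgroup Γ) [hV : IsClosed (V : Set Γ)] [hV' : IsClosed (V' : Set Γ)]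
  [hVn : V.Normal] [hV'n : V'.Normal]
variable {M : Type u} [AddCommGroup M] [TopologicalSpace M] [DiscreteTopology M]
variable (ρ : ContinuousRep Γ ℤ M) (g : Γ)

variable (h : V' ≤ V)

omit [CompactSpace Γ] [T2Space Γ] [TotallyDisconnectedSpace Γ] hV hV' in
/-- **`res_{V'/V} ∘ (g ·) = (g ·) ∘ res_{V'/V}` in every degree**: both composites are the map of the
pair `(V' → V, s ↦ g⁻¹sg; m ↦ g·m)`. [cite: NeukirchSchmidtWingberg2008, I §5 Prop. 1.5.4] -/
theorem resLe_conjMap (q : ℕ) (y : continuousCohomology q (subgroupRep ρ.toTopRep V)) :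
    resLe ρ.toTopRep h q (conjMap ρ.toTopRep V g q y) =
      conjMap ρ.toTopRep V' g q (resLe ρ.toTopRep h q y) := by
  -- the module half `m ↦ g·m` of the common pair
  let hg : TopRep.res (((subgroupConj V g).comp (subgroupInclusion h) : V' →ₜ* V) : V' →* V)
      (subgroupRep ρ.toTopRep V) ⟶ subgroupRep ρ.toTopRep V' :=
    TopRep.ofHom ⟨(ρ.toTopRep.ρ g : M →L[ℤ] M), fun x => by
      ext m
      change ρ g (ρ (g⁻¹ * (x : Γ) * g) m) = ρ (x : Γ) (ρ g m)
      rw [mul_assoc, map_mul, Module.End.mul_apply, ← Module.End.mul_apply (ρ g), ← map_mul,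
        mul_inv_cancel, map_one, Module.End.one_apply, map_mul, Module.End.mul_apply]⟩
  have h1 : ContinuousCohomology.map ((subgroupConj V g).comp (subgroupInclusion h)) hg q y =
      resLe ρ.toTopRep h q (conjMap ρ.toTopRep V g q y) :=
    map_comp_apply_of (X := subgroupRep ρ.toTopRep V) (Y := subgroupRep ρ.toTopRep V)
      (Z := subgroupRep ρ.toTopRep V') (subgroupConj V g) (subgroupInclusion h)
      ((subgroupConj V g).comp (subgroupInclusion h)) (fun _ => rfl)
      (conjRepHom ρ.toTopRep V g) (TopRep.ofHom ⟨ContinuousLinearMap.id ℤ M, fun _ => rfl⟩) hg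
      (fun _ => rfl) q y
  have h2 : ContinuousCohomology.map ((subgroupConj V g).comp (subgroupInclusion h)) hg q y =
      conjMap ρ.toTopRep V' g q (resLe ρ.toTopRep h q y) :=
    map_comp_apply_of (X := subgroupRep ρ.toTopRep V) (Y := subgroupRep ρ.toTopRep V')
      (Z := subgroupRep ρ.toTopRep V') (subgroupInclusion h) (subgroupConj V' g)
      ((subgroupConj V g).comp (subgroupInclusion h)) (fun _ => rfl)
      (TopRep.ofHom ⟨ContinuousLinearMap.id ℤ M, fun _ => rfl⟩) (conjRepHom ρ.toTopRep V' g) hg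
      (fun _ => rfl) q y
  rw [← h1, h2]

omit [CompactSpace Γ] [T2Space Γ] [TotallyDisconnectedSpace Γ] hV hV' hVn hV'n in
/-- `toSubgroupOf ∘ res_{V'/V} = res_{(V'.subgroupOf V)/V}` (both pull back along `V'.subgroupOf V → V`
with the identity on `M`). [cite: SerreGaloisCohomology1997, I §2.5] -/
theorem toSubgroupOf_resLe (q : ℕ) (y : continuousCohomology q (subgroupRep ρ.toTopRep V)) :
    toSubgroupOf ρ.toTopRep h q (resLe ρ.toTopRep h q y) =
      resH (V'.subgroupOf V) (ρ.restrict (subgroupIncl V)) q y :=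
  (map_comp_apply_of (X := subgroupRep ρ.toTopRep V) (Y := subgroupRep ρ.toTopRep V')
    (Z := subgroupRep (subgroupRep ρ.toTopRep V) (V'.subgroupOf V))
    (subgroupInclusion h) (subgroupOfHom h) (subgroupIncl (V'.subgroupOf V))
    (fun _ => rfl) (TopRep.ofHom ⟨ContinuousLinearMap.id ℤ M, fun _ => rfl⟩)
    (TopRep.ofHom ⟨ContinuousLinearMap.id ℤ M, fun _ => rfl⟩)
    (𝟙 (((ρ.restrict (subgroupIncl V)).restrict (subgroupIncl (V'.subgroupOf V))).toTopRep))
    (fun _ => rfl) q y).symm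

variable [Fintype (V ⧸ V'.subgroupOf V)]

omit hVn hV'n in
/-- **`cor_{V/V'} ∘ res_{V'/V} = (V : V')`** on `H^{q+1}(V, M)` (the tree's `cor_resH` for the profinite
group `↥V` along `V'.subgroupOf V`, read through `relCor = cor ∘ toSubgroupOf`).
[cite: SerreGaloisCohomology1997, I §2.4 Prop. 9] -/
theorem relCor_resLe (q : ℕ) (y : continuousCohomology (q + 1) (subgroupRep ρ.toTopRep V)) :
    relCor V V' ρ h (q + 1) (resLe ρ.toTopRep h (q + 1) y) = (V'.subgroupOf V).index • y := by
  haveI := isClosed_subgroupOf_of_isClosed V V'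
  rw [relCor_apply]
  have e := toSubgroupOf_resLe V V' ρ h (q + 1) y
  have hc := cor_resH (V'.subgroupOf V) (ρ.restrict (subgroupIncl V)) q y
  change cor (V'.subgroupOf V) (ρ.restrict (subgroupIncl V)) (q + 1)
      (resH (V'.subgroupOf V) (ρ.restrict (subgroupIncl V)) (q + 1) y) = _ at hc
  rw [← e] at hc
  exact hc

end Profinite

/-! ### §3 Local fields: the prime-index step and the induction on `(Γ_F : S)` -/

section Local

variable (F : Type u) [Field F] [ValuativeRel F] [TopologicalSpace F] [IsNonarchimedeanLocalField F]
  [CharZero F]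

/-- **`|H²(V, μ_n)| = n` for every OPEN subgroup `V ≤ Γ_F`** (the tree's `natCard_two_mu_eq` for
`V = Gal(F̄/F̄^V)`). [cite: SerreLocalFields1979, XIII §3; SerreGaloisCohomology1997, II §5.2] -/
theorem natCard_two_mu_eq_of_isOpen (V : Subgroup (absoluteGaloisGroup F))
    (hV : IsOpen (V : Set (absoluteGaloisGroup F))) (n : ℕ) [NeZero n] :
    Nat.card (continuousCohomology 2 ((mu F n).restrict (subgroupIncl V)).toTopRep) = n := by
  obtain ⟨E, hE, rfl⟩ := exists_galFixing_eq_of_isOpen V hV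
  exact natCard_two_mu_eq F E n

/-- `H²(V, μ_n)` is cyclic for every open `V ≤ Γ_F`. [cite: SerreLocalFields1979, XIII §3 Cor. 3] -/
theorem isAddCyclic_two_mu_of_isOpen (V : Subgroup (absoluteGaloisGroup F))
    (hV : IsOpen (V : Set (absoluteGaloisGroup F))) (n : ℕ) [NeZero n] :
    IsAddCyclic (continuousCohomology 2 ((mu F n).restrict (subgroupIncl V)).toTopRep) := by
  obtain ⟨E, hE, rfl⟩ := exists_galFixing_eq_of_isOpen V hV
  exact isAddCyclic_two_mu F E n

/-- `H²(V, μ_n)` is finite for every open `V ≤ Γ_F`. [cite: SerreLocalFields1979, XIII §3] -/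
theorem finite_two_mu_of_isOpen (V : Subgroup (absoluteGaloisGroup F))
    (hV : IsOpen (V : Set (absoluteGaloisGroup F))) (n : ℕ) [NeZero n] :
    Finite (continuousCohomology 2 ((mu F n).restrict (subgroupIncl V)).toTopRep) := by
  obtain ⟨E, hE, rfl⟩ := exists_galFixing_eq_of_isOpen V hV
  exact finite_two_mu F E n

/-- **The prime-index step.** `V' ≤ V` open normal subgroups of `Γ_F` with `(V : V') = ℓ` prime,
`k ≥ 2`, `g ∈ Γ_F` acting trivially on `H²(V, μ_{p^k})` ⇒ `g` acts trivially on `H²(V', μ_{p^k})`: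
the endomorphism `g ·` of the cyclic group `H²(V', μ_{p^k})` of order `p^k` satisfies
`cor_{V/V'} ∘ (g ·) = (g ·) ∘ cor = cor` and `(g ·) ∘ res = res ∘ (g ·) = res`, and `cor ∘ res = ℓ`
(§1 `eq_self_of_comp_eq_of_comp_eq`). [cite: SerreLocalFields1979, XIII §3 Prop. 7] -/
theorem conjMap_two_mu_eq_self_of_step {p k : ℕ} (hp : p.Prime) (hk : 2 ≤ k)
    (V V' : Subgroup (absoluteGaloisGroup F)) [IsClosed (V : Set (absoluteGaloisGroup F))]
    [IsClosed (V' : Set (absoluteGaloisGroup F))] [V.Normal] [V'.Normal] (h : V' ≤ V)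
    (hVo : IsOpen (V : Set (absoluteGaloisGroup F))) (hV'o : IsOpen (V' : Set (absoluteGaloisGroup F)))
    (hℓ : ((V'.subgroupOf V).index).Prime) (g : absoluteGaloisGroup F)
    (hVg : ∀ y : continuousCohomology 2 ((mu F (p ^ k)).restrict (subgroupIncl V)).toTopRep,
      conjMap (mu F (p ^ k)).toTopRep V g 2 y = y)
    (z : continuousCohomology 2 ((mu F (p ^ k)).restrict (subgroupIncl V')).toTopRep) :
    conjMap (mu F (p ^ k)).toTopRep V' g 2 z = z := by
  haveI : NeZero (p ^ k) := ⟨pow_ne_zero k hp.ne_zero⟩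
  haveI : Fintype (V ⧸ V'.subgroupOf V) := Subgroup.fintypeOfIndexNeZero hℓ.ne_zero
  haveI := finite_two_mu_of_isOpen F V' hV'o (p ^ k)
  refine eq_self_of_comp_eq_of_comp_eq (isAddCyclic_two_mu_of_isOpen F V hVo (p ^ k))
    (isAddCyclic_two_mu_of_isOpen F V' hV'o (p ^ k)) hp hk hℓ
    (natCard_two_mu_eq_of_isOpen F V hVo (p ^ k)) (natCard_two_mu_eq_of_isOpen F V' hV'o (p ^ k))
    (resLe (mu F (p ^ k)).toTopRep h 2).hom.toLinearMap.toAddMonoidHom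
    (relCor V V' (mu F (p ^ k)) h 2).hom.toLinearMap.toAddMonoidHom
    (fun a => relCor_resLe V V' (mu F (p ^ k)) h 1 a)
    (fun b => conjMap (mu F (p ^ k)).toTopRep V' g 2 b) (fun b => ?_) (fun a => ?_) z
  · change relCor V V' (mu F (p ^ k)) h 2 (conjMap (mu F (p ^ k)).toTopRep V' g 2 b) =
      relCor V V' (mu F (p ^ k)) h 2 b
    rw [relCor_conjMap, hVg]
  · change conjMap (mu F (p ^ k)).toTopRep V' g 2 (resLe (mu F (p ^ k)).toTopRep h 2 a) =
      resLe (mu F (p ^ k)).toTopRep h 2 a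
    rw [← resLe_conjMap, hVg]

/-- The induction on the index (auxiliary form with the index as a parameter).
[cite: SerreLocalFields1979, XIII §3 Prop. 7] -/
private theorem conjMap_two_mu_eq_self_aux {p k : ℕ} (hp : p.Prime) (hk : 2 ≤ k) (m : ℕ) :
    ∀ (S : Subgroup (absoluteGaloisGroup F)) [S.Normal] [IsClosed (S : Set (absoluteGaloisGroup F))],
      S.index = m → IsOpen (S : Set (absoluteGaloisGroup F)) →
      (∀ x y : absoluteGaloisGroup F, x * y * x⁻¹ * y⁻¹ ∈ S) →
      ∀ (g : absoluteGaloisGroup F)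
        (z : continuousCohomology 2 ((mu F (p ^ k)).restrict (subgroupIncl S)).toTopRep),
        conjMap (mu F (p ^ k)).toTopRep S g 2 z = z := by
  induction m using Nat.strong_induction_on with
  | _ m ih =>
    intro S _ _ hm hSo hab g z
    by_cases htop : S = ⊤
    · have hg : g ∈ S := by rw [htop]; exact Subgroup.mem_top g
      exact conjMap_eq_self_of_mem_two (X := (mu F (p ^ k)).toTopRep) (N := S) hg z
    · haveI : Finite (absoluteGaloisGroup F ⧸ S) := Subgroup.quotient_finite_of_isOpen S hSo
      have hSi : S.index = Nat.card (absoluteGaloisGroup F ⧸ S) := Subgroup.index_eq_card S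
      have hcard : Nat.card (absoluteGaloisGroup F ⧸ S) ≠ 1 := by
        rw [← hSi, Ne, Subgroup.index_eq_one]; exact htop
      obtain ⟨ℓ, hℓ, hℓd⟩ := Nat.exists_prime_and_dvd hcard
      haveI := Fact.mk hℓ
      obtain ⟨x, hx⟩ := exists_prime_orderOf_dvd_card' ℓ hℓd
      let V₁ : Subgroup (absoluteGaloisGroup F) := (Subgroup.zpowers x).comap (QuotientGroup.mk' S)
      have hSV₁ : S ≤ V₁ := fun s hs => by
        change QuotientGroup.mk' S s ∈ Subgroup.zpowers x
        rw [show QuotientGroup.mk' S s = 1 from (QuotientGroup.eq_one_iff s).mpr hs]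
        exact one_mem _
      haveI hV₁n : V₁.Normal := ⟨fun t ht y => by
        have e : y * t * y⁻¹ = (y * t * y⁻¹ * t⁻¹) * t := by group
        rw [e]; exact V₁.mul_mem (hSV₁ (hab y t)) ht⟩
      have hV₁o : IsOpen (V₁ : Set (absoluteGaloisGroup F)) := Subgroup.isOpen_mono hSV₁ hSo
      haveI : IsClosed (V₁ : Set (absoluteGaloisGroup F)) := V₁.isClosed_of_isOpen hV₁o
      -- `(V₁ : S) = ℓ`
      have hi1 : V₁.index = (Subgroup.zpowers x).index :=
        Subgroup.index_comap_of_surjective (Subgroup.zpowers x) (QuotientGroup.mk'_surjective S)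
      have hi3 : (Subgroup.zpowers x).index * ℓ = Nat.card (absoluteGaloisGroup F ⧸ S) := by
        rw [← hx, ← Nat.card_zpowers x]; exact Subgroup.index_mul_card _
      have hi4 := Subgroup.relIndex_mul_index hSV₁
      have hzi : (Subgroup.zpowers x).index ≠ 0 := Subgroup.FiniteIndex.index_ne_zero
      rw [hi1, hSi, ← hi3, mul_comm (Subgroup.zpowers x).index] at hi4
      have hrel : (S.subgroupOf V₁).index = ℓ := Nat.eq_of_mul_eq_mul_right (Nat.pos_of_ne_zero hzi) hi4
      -- `(Γ_F : V₁) < (Γ_F : S)`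
      have hlt : V₁.index < m := by
        rw [← hm, hSi, ← hi3, ← hi1]
        exact (Nat.lt_mul_iff_one_lt_right (Nat.pos_of_ne_zero (hi1 ▸ hzi))).mpr hℓ.one_lt
      have hV₁ : ∀ (g' : absoluteGaloisGroup F)
          (y : continuousCohomology 2 ((mu F (p ^ k)).restrict (subgroupIncl V₁)).toTopRep),
          conjMap (mu F (p ^ k)).toTopRep V₁ g' 2 y = y :=
        ih V₁.index hlt V₁ rfl hV₁o (fun a b => hSV₁ (hab a b))
      exact conjMap_two_mu_eq_self_of_step F hp hk V₁ S hSV₁ hV₁o hSo (hrel ▸ hℓ) g (hV₁ g) z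

/-- **`Γ_F` acts trivially on `H²(S, μ_{p^k})` for `S ⊴ Γ_F` open with `Γ_F/S` abelian, `k ≥ 2`.**
For every `g ∈ Γ_F` the conjugation action `g ·` (the tree's `conjMap`) on `H²(S, μ_{p^k}(F̄))` is the
identity: induction on `(Γ_F : S)` along `S ≤ V₁ ≤ Γ_F`, `V₁/S` cyclic of prime order (Cauchy in the
finite abelian group `Γ_F/S`; `V₁ ⊴ Γ_F` because `Γ_F/S` is abelian), each step by
`conjMap_two_mu_eq_self_of_step`. Equivalently (`cor ∘ (g ·) = (g ·) ∘ cor`): the local invariant map of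
the finite abelian extension `E = F̄^S` is `Gal(E/F)`-invariant, `inv_{E} ∘ g_* = inv_E`.
[cite: SerreLocalFields1979, XI §2 Prop. 1 (ii), XIII §3 Prop. 7] [cite: NeukirchSchmidtWingberg2008, II §7 Cor. 7.1.4] -/
theorem conjMap_two_mu_eq_self_of_comm_mem {p k : ℕ} (hp : p.Prime) (hk : 2 ≤ k)
    (S : Subgroup (absoluteGaloisGroup F)) [S.Normal] [IsClosed (S : Set (absoluteGaloisGroup F))]
    (hSo : IsOpen (S : Set (absoluteGaloisGroup F)))
    (hab : ∀ x y : absoluteGaloisGroup F, x * y * x⁻¹ * y⁻¹ ∈ S) (g : absoluteGaloisGroup F)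
    (z : continuousCohomology 2 ((mu F (p ^ k)).restrict (subgroupIncl S)).toTopRep) :
    conjMap (mu F (p ^ k)).toTopRep S g 2 z = z :=
  conjMap_two_mu_eq_self_aux F hp hk S.index S rfl hSo hab g z

/-- The same for a subgroup containing the kernel of a homomorphism to an abelian group (the form in
which layer subgroups `Γ_{F} ∩ Gal(K̄/K_n)` of a `ℤ_p^d`-tower, intersected with the kernel of a
character, arise). [cite: SerreLocalFields1979, XIII §3 Prop. 7] -/
theorem conjMap_two_mu_eq_self_of_ker_le {p k : ℕ} (hp : p.Prime) (hk : 2 ≤ k)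
    {C : Type*} [CommGroup C] (f : absoluteGaloisGroup F →* C)
    (S : Subgroup (absoluteGaloisGroup F)) [S.Normal] [IsClosed (S : Set (absoluteGaloisGroup F))]
    (hSo : IsOpen (S : Set (absoluteGaloisGroup F))) (hker : f.ker ≤ S) (g : absoluteGaloisGroup F)
    (z : continuousCohomology 2 ((mu F (p ^ k)).restrict (subgroupIncl S)).toTopRep) :
    conjMap (mu F (p ^ k)).toTopRep S g 2 z = z :=
  conjMap_two_mu_eq_self_of_comm_mem F hp hk S hSo
    (fun x y => hker (by rw [MonoidHom.mem_ker, map_mul, map_mul, map_mul, map_inv, map_inv,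
      mul_inv_cancel_comm, mul_inv_cancel])) g z

end Local

end Literature.NumberTheory.GaloisRepresentations

end
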